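import Mathlib

/-!
# Lemmas for the far-rider per-position kept bound (classes, charging, scalar endgame)

Crux `Summit.MatrixMultiplication.MatrixMultiplication.Theses.SnSubsetDichotomy.PolynomialSlack`
(item `stmt-MatrixMultiplication-8306`), level-one programme, line transport-split-hull (lead c10):
the self-contained pieces of the proof of `position_kept_bound_far`
(file `…PositionKeptBoundFar`), split off by topic.

* `far_kept_pair_bound` (STEP A, one pair): a kept value is at most the productive included mass,
  minus the hub penalty on `T`-pairs, plus `ε₂ σ' ρ' + 2 ε₁ (σ' + ρ')`.
* `far_kept_sq_sum_sum_le` (STEP C): Cauchy–Schwarz over the `m · m` pairs.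
* `far_kept_split3`, `far_kept_split2`, `far_kept_boxes`: bookkeeping of the three classes of the
  levels of one side by log-size `l` — cheap `C` (`0.525 L < l`), mid `M`
  (`0.485 L ≤ l ≤ 0.525 L`), dear `H` (`l < 0.485 L`) — and the rate boxes of their costs
  `u = w (1 - l / L)` when `l ∈ [0.245 L, 0.755 L]`.
* `far_kept_charge_le` (STEP F'): along a relation whose pairs have `la + lb ≤ 1.01 L`, a cheap
  level meets only dear levels and a mid level only mid or dear ones, so
  `∑_{Dep} f g ≤ fH (gC + gM + gH) + fM (gM + gH) + fC gH`.
* `far_kept_tail_le`, `far_kept_real_core` (STEP E'): the scalar endgame; the correction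
  `(100/99) Hi (X + Y)` is absorbed by the penalty `≥ (225 M / 512 m²) Hi²` after completing the
  square, at the price `(X + Y)² m² / M`.
-/

namespace Summit.MatrixMultiplication.MatrixMultiplication.Theorems.PolynomialSlack

set_option linter.dupNamespace false

open scoped BigOperators

/-- **STEP A for one pair.**  `σ ≤ σ'`, `ρ ≤ ρ'` the masses of the two levels (`15/16 σ' ≤ σ`),
`cab ≤ σ' ρ'` the kept value, `s₁, r₁ ≥ 0` the included masses (equal to `σ', ρ'` when both levels
are substantial and the pair is depleted, `hI`), non-depleted pairs keep `≤ ε₂ σ ρ`, `T`-pairs keep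
`≤ -(M/2) σ ρ`.  Then `cab ≤ [D] s₁ r₁ - [T] (M/2) σ ρ + ε₂ σ' ρ' + 2 ε₁ (ρ' + σ')`. -/
theorem far_kept_pair_bound {σ σ' ρ ρ' cab ε₁ ε₂ M s₁ r₁ : ℝ} {D T : Prop} [Decidable D]
    [Decidable T] (hε₁ : 0 < ε₁) (hε₂ : 0 < ε₂) (hσ : 0 ≤ σ ∧ σ ≤ σ' ∧ 15 / 16 * σ' ≤ σ)
    (hρ : 0 ≤ ρ ∧ ρ ≤ ρ' ∧ 15 / 16 * ρ' ≤ ρ) (hs₁ : 0 ≤ s₁) (hr₁ : 0 ≤ r₁)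
    (hI : ε₁ ≤ σ → ε₁ ≤ ρ → D → s₁ * r₁ = σ' * ρ') (hc : cab ≤ σ' * ρ')
    (hcdep : ¬ D → cab ≤ ε₂ * σ * ρ) (hTc : T → cab ≤ -(M / 2) * σ * ρ) :
    cab ≤ (if D then s₁ * r₁ else 0) - (if T then M / 2 * (σ * ρ) else 0) + ε₂ * (σ' * ρ')
      + (2 * ε₁ * ρ' + 2 * ε₁ * σ') := by
  obtain ⟨hσ0, hσle, hσ15⟩ := hσ
  obtain ⟨hρ0, hρle, hρ15⟩ := hρ
  have hσ'0 : 0 ≤ σ' := hσ0.trans hσle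
  have hρ'0 : 0 ≤ ρ' := hρ0.trans hρle
  have h1 : 0 ≤ (if D then s₁ * r₁ else 0) := by split_ifs; exacts [mul_nonneg hs₁ hr₁, le_rfl]
  have h2 : 0 ≤ ε₂ * (σ' * ρ') := mul_nonneg hε₂.le (mul_nonneg hσ'0 hρ'0)
  have h3 : 0 ≤ 2 * ε₁ * ρ' := mul_nonneg (by linarith) hρ'0
  have h4 : 0 ≤ 2 * ε₁ * σ' := mul_nonneg (by linarith) hσ'0
  by_cases hT : T
  · rw [if_pos hT]; linarith [hTc hT]
  rw [if_neg hT, sub_zero]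
  by_cases ha : ε₁ ≤ σ
  · by_cases hb : ε₁ ≤ ρ
    · by_cases hd : D
      · rw [if_pos hd, hI ha hb hd]; linarith
      · have h6 : ε₂ * σ * ρ ≤ ε₂ * (σ' * ρ') := by
          rw [mul_assoc]
          exact mul_le_mul_of_nonneg_left (mul_le_mul hσle hρle hρ0 hσ'0) hε₂.le
        linarith [hcdep hd]
    · have h5 : ρ' ≤ 2 * ε₁ := by linarith [not_le.1 hb]
      have h6 : σ' * ρ' ≤ σ' * (2 * ε₁) := mul_le_mul_of_nonneg_left h5 hσ'0
      linarith
  · have h5 : σ' ≤ 2 * ε₁ := by linarith [not_le.1 ha]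
    have h6 : σ' * ρ' ≤ 2 * ε₁ * ρ' := mul_le_mul_of_nonneg_right h5 hρ'0
    linarith

/-- **STEP C**: Cauchy–Schwarz over the `m · m` pairs, `(∑∑ g)² ≤ m² ∑∑ g²`. -/
theorem far_kept_sq_sum_sum_le {m : ℕ} (g : Fin m → Fin m → ℝ) :
    (∑ a, ∑ b, g a b) ^ 2 ≤ (m : ℝ) * m * ∑ a, ∑ b, g a b ^ 2 := by
  have h1 : (∑ a, ∑ b, g a b) ^ 2 ≤ m * ∑ a, (∑ b, g a b) ^ 2 := by
    simpa [Finset.card_univ, Fintype.card_fin] using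
      sq_sum_le_card_mul_sum_sq (s := Finset.univ) (f := fun a => ∑ b, g a b)
  have h2 : ∀ a, (∑ b, g a b) ^ 2 ≤ m * ∑ b, g a b ^ 2 := fun a => by
    simpa [Finset.card_univ, Fintype.card_fin] using
      sq_sum_le_card_mul_sum_sq (s := Finset.univ) (f := fun b => g a b)
  calc (∑ a, ∑ b, g a b) ^ 2 ≤ m * ∑ a, (∑ b, g a b) ^ 2 := h1
    _ ≤ m * ∑ a, (m * ∑ b, g a b ^ 2) :=
        mul_le_mul_of_nonneg_left (Finset.sum_le_sum fun a _ => h2 a) (Nat.cast_nonneg m)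
    _ = _ := by rw [← Finset.mul_sum]; ring

/-- Trichotomy of the classes: a sum splits into its cheap (`0.525 L < l`), mid and dear
(`l < 0.485 L`) parts. -/
theorem far_kept_split3 {m : ℕ} (t l : Fin m → ℝ) {L : ℝ} (hL : 0 < L) :
    ∑ a, t a = (∑ a, if 525 / 1000 * L < l a then t a else 0)
      + (∑ a, if 485 / 1000 * L ≤ l a ∧ l a ≤ 525 / 1000 * L then t a else 0)
      + (∑ a, if l a < 485 / 1000 * L then t a else 0) := by
  rw [← Finset.sum_add_distrib, ← Finset.sum_add_distrib]
  refine Finset.sum_congr rfl fun a _ => ?_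
  rcases lt_or_ge (l a) (485 / 1000 * L) with h1 | h1
  · have h2 : ¬ 525 / 1000 * L < l a := fun h => by linarith
    have h3 : ¬ (485 / 1000 * L ≤ l a ∧ l a ≤ 525 / 1000 * L) := fun h => by linarith [h.1]
    rw [if_pos h1, if_neg h2, if_neg h3]; ring
  · rcases le_or_gt (l a) (525 / 1000 * L) with h2 | h2
    · rw [if_neg (not_lt.2 h2), if_pos (And.intro h1 h2), if_neg (not_lt.2 h1)]; ring
    · have h3 : ¬ (485 / 1000 * L ≤ l a ∧ l a ≤ 525 / 1000 * L) := fun h => (not_lt.2 h.2) h2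
      rw [if_pos h2, if_neg h3, if_neg (not_lt.2 h1)]; ring

/-- The non-cheap part (`l ≤ 0.525 L`) of a sum is its mid part plus its dear part. -/
theorem far_kept_split2 {m : ℕ} (t l : Fin m → ℝ) {L : ℝ} (hL : 0 < L) :
    (∑ a, if l a ≤ 525 / 1000 * L then t a else 0)
      = (∑ a, if 485 / 1000 * L ≤ l a ∧ l a ≤ 525 / 1000 * L then t a else 0)
      + (∑ a, if l a < 485 / 1000 * L then t a else 0) := by
  rw [← Finset.sum_add_distrib]
  refine Finset.sum_congr rfl fun a _ => ?_
  rcases lt_or_ge (l a) (485 / 1000 * L) with h1 | h1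
  · rcases le_or_gt (l a) (525 / 1000 * L) with h2 | h2
    · have h3 : ¬ (485 / 1000 * L ≤ l a ∧ l a ≤ 525 / 1000 * L) := fun h => (not_le.2 h1) h.1
      rw [if_pos h2, if_neg h3, if_pos h1]; ring
    · -- impossible ordering `0.525 L < l < 0.485 L`
      exfalso; linarith
  · rcases le_or_gt (l a) (525 / 1000 * L) with h2 | h2
    · rw [if_pos h2, if_pos (And.intro h1 h2), if_neg (not_lt.2 h1)]; ring
    · have h3 : ¬ (485 / 1000 * L ≤ l a ∧ l a ≤ 525 / 1000 * L) := fun h => (not_lt.2 h.2) h2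
      rw [if_neg (not_le.2 h2), if_neg h3, if_neg (not_lt.2 h1)]; ring

/-- The rate boxes of the three classes of one side: if `u = w · (1 - l/L)` with `w ≥ 0` and
`l ∈ [0.245 L, 0.755 L]` wherever `w ≠ 0`, then the cheap, mid and dear class costs lie in
`[0.245, 0.475]`, `[0.475, 0.515]`, `[0.515, 0.755]` times the class masses. -/
theorem far_kept_boxes {m : ℕ} (w u l : Fin m → ℝ) {L : ℝ} (hL : 0 < L) (hw : ∀ a, 0 ≤ w a)
    (hu : ∀ a, u a = w a * (1 - l a / L))
    (hrate : ∀ a, w a ≠ 0 → 245 / 1000 * L ≤ l a ∧ l a ≤ 755 / 1000 * L) :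
    (245 / 1000 * (∑ a, if 525 / 1000 * L < l a then w a else 0)
        ≤ (∑ a, if 525 / 1000 * L < l a then u a else 0) ∧
      (∑ a, if 525 / 1000 * L < l a then u a else 0)
        ≤ 475 / 1000 * (∑ a, if 525 / 1000 * L < l a then w a else 0)) ∧
    (475 / 1000 * (∑ a, if 485 / 1000 * L ≤ l a ∧ l a ≤ 525 / 1000 * L then w a else 0)
        ≤ (∑ a, if 485 / 1000 * L ≤ l a ∧ l a ≤ 525 / 1000 * L then u a else 0) ∧
      (∑ a, if 485 / 1000 * L ≤ l a ∧ l a ≤ 525 / 1000 * L then u a else 0)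
        ≤ 515 / 1000 * (∑ a, if 485 / 1000 * L ≤ l a ∧ l a ≤ 525 / 1000 * L then w a else 0)) ∧
    (515 / 1000 * (∑ a, if l a < 485 / 1000 * L then w a else 0)
        ≤ (∑ a, if l a < 485 / 1000 * L then u a else 0) ∧
      (∑ a, if l a < 485 / 1000 * L then u a else 0)
        ≤ 755 / 1000 * (∑ a, if l a < 485 / 1000 * L then w a else 0)) := by
  -- a box for a general class predicate `P`
  have hbox : ∀ (P : Fin m → Prop) [DecidablePred P] (lo hi : ℝ),
      (∀ a, P a → w a ≠ 0 → lo ≤ 1 - l a / L ∧ 1 - l a / L ≤ hi) →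
      lo * (∑ a, if P a then w a else 0) ≤ (∑ a, if P a then u a else 0) ∧
        (∑ a, if P a then u a else 0) ≤ hi * (∑ a, if P a then w a else 0) := by
    intro P _ lo hi hP
    have hpt : ∀ a, lo * (if P a then w a else 0) ≤ (if P a then u a else 0) ∧
        (if P a then u a else 0) ≤ hi * (if P a then w a else 0) := by
      intro a
      split_ifs with hp
      · rw [hu a]
        rcases eq_or_ne (w a) 0 with h0 | h0
        · rw [h0]; simp
        · obtain ⟨h1, h2⟩ := hP a hp h0
          have hw' : 0 < w a := (hw a).lt_of_ne' h0
          constructor <;> nlinarith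
      · simp
    constructor
    · rw [Finset.mul_sum]; exact Finset.sum_le_sum fun a _ => (hpt a).1
    · rw [Finset.mul_sum]; exact Finset.sum_le_sum fun a _ => (hpt a).2
  have hr : ∀ a, w a ≠ 0 → 245 / 1000 ≤ 1 - l a / L ∧ 1 - l a / L ≤ 755 / 1000 := by
    intro a ha
    obtain ⟨h1, h2⟩ := hrate a ha
    constructor
    · have : l a / L ≤ 755 / 1000 := by rw [div_le_iff₀ hL]; linarith
      linarith
    · have : 245 / 1000 ≤ l a / L := by rw [le_div_iff₀ hL]; linarith
      linarith
  refine ⟨?_, ?_, ?_⟩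
  · refine hbox _ _ _ fun a (hp : 525 / 1000 * L < l a) h0 => ?_
    have : 525 / 1000 < l a / L := by rw [lt_div_iff₀ hL]; linarith
    exact ⟨(hr a h0).1, by linarith⟩
  · refine hbox _ _ _ fun a (hp : 485 / 1000 * L ≤ l a ∧ l a ≤ 525 / 1000 * L) _ => ?_
    have h1 : 485 / 1000 ≤ l a / L := by rw [le_div_iff₀ hL]; linarith [hp.1]
    have h2 : l a / L ≤ 525 / 1000 := by rw [div_le_iff₀ hL]; linarith [hp.2]
    exact ⟨by linarith, by linarith⟩
  · refine hbox _ _ _ fun a (hp : l a < 485 / 1000 * L) h0 => ?_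
    have : l a / L < 485 / 1000 := by rw [div_lt_iff₀ hL]; linarith
    exact ⟨by linarith, (hr a h0).2⟩

/-- **Charging lemma (STEP F').**  Nonnegative weights `f` (the costs of one side) and `g` (the
masses of the other side), a relation `Dep` whose pairs have `la + lb ≤ 1.01 L`: a cheap level
(`la > 0.525 L`) is related only to dear levels (`lb < 0.485 L`), a mid level only to mid or dear
levels, so `∑_{Dep} f g ≤ fH · (gC + gM + gH) + fM · (gM + gH) + fC · gH`. -/
theorem far_kept_charge_le {α β : Type*} [Fintype α] [Fintype β] (f la : α → ℝ) (g lb : β → ℝ)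
    (Dep : α → β → Prop) [DecidableRel Dep] (L : ℝ) (hf : ∀ a, 0 ≤ f a) (hg : ∀ b, 0 ≤ g b)
    (hD : ∀ a b, Dep a b → la a + lb b ≤ 101 / 100 * L) :
    ∑ a, ∑ b, (if Dep a b then f a * g b else 0)
      ≤ (∑ a, if la a < 485 / 1000 * L then f a else 0)
          * ((∑ b, if 525 / 1000 * L < lb b then g b else 0)
            + (∑ b, if 485 / 1000 * L ≤ lb b ∧ lb b ≤ 525 / 1000 * L then g b else 0)
            + (∑ b, if lb b < 485 / 1000 * L then g b else 0))
        + (∑ a, if 485 / 1000 * L ≤ la a ∧ la a ≤ 525 / 1000 * L then f a else 0)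
          * ((∑ b, if 485 / 1000 * L ≤ lb b ∧ lb b ≤ 525 / 1000 * L then g b else 0)
            + (∑ b, if lb b < 485 / 1000 * L then g b else 0))
        + (∑ a, if 525 / 1000 * L < la a then f a else 0)
          * (∑ b, if lb b < 485 / 1000 * L then g b else 0) := by
  -- pointwise bound
  have hpt : ∀ a b, (if Dep a b then f a * g b else 0)
      ≤ (if la a < 485 / 1000 * L then f a else 0)
          * ((if 525 / 1000 * L < lb b then g b else 0)
            + (if 485 / 1000 * L ≤ lb b ∧ lb b ≤ 525 / 1000 * L then g b else 0)
            + (if lb b < 485 / 1000 * L then g b else 0))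
        + (if 485 / 1000 * L ≤ la a ∧ la a ≤ 525 / 1000 * L then f a else 0)
          * ((if 485 / 1000 * L ≤ lb b ∧ lb b ≤ 525 / 1000 * L then g b else 0)
            + (if lb b < 485 / 1000 * L then g b else 0))
        + (if 525 / 1000 * L < la a then f a else 0)
          * (if lb b < 485 / 1000 * L then g b else 0) := by
    intro a b
    have hgC : 0 ≤ (if 525 / 1000 * L < lb b then g b else 0) := by
      split_ifs; exacts [hg b, le_rfl]
    have hgM : 0 ≤ (if 485 / 1000 * L ≤ lb b ∧ lb b ≤ 525 / 1000 * L then g b else 0) := by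
      split_ifs; exacts [hg b, le_rfl]
    have hgH : 0 ≤ (if lb b < 485 / 1000 * L then g b else 0) := by
      split_ifs; exacts [hg b, le_rfl]
    have hfH : 0 ≤ (if la a < 485 / 1000 * L then f a else 0) := by
      split_ifs; exacts [hf a, le_rfl]
    have hfM : 0 ≤ (if 485 / 1000 * L ≤ la a ∧ la a ≤ 525 / 1000 * L then f a else 0) := by
      split_ifs; exacts [hf a, le_rfl]
    have hfC : 0 ≤ (if 525 / 1000 * L < la a then f a else 0) := by
      split_ifs; exacts [hf a, le_rfl]
    have h1 := mul_nonneg hfH (add_nonneg (add_nonneg hgC hgM) hgH)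
    have h2 := mul_nonneg hfM (add_nonneg hgM hgH)
    have h3 := mul_nonneg hfC hgH
    by_cases hd : Dep a b
    swap
    · rw [if_neg hd]; linarith
    rw [if_pos hd]
    have hs := hD a b hd
    rcases lt_or_ge (la a) (485 / 1000 * L) with haH | haH
    · -- dear `a`: any partner
      have hcov : g b ≤ (if 525 / 1000 * L < lb b then g b else 0)
          + (if 485 / 1000 * L ≤ lb b ∧ lb b ≤ 525 / 1000 * L then g b else 0)
          + (if lb b < 485 / 1000 * L then g b else 0) := by
        rcases lt_or_ge (lb b) (485 / 1000 * L) with hb | hb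
        · rw [if_pos hb]; linarith
        · rcases le_or_gt (lb b) (525 / 1000 * L) with hb2 | hb2
          · rw [if_pos (And.intro hb hb2)]; linarith
          · rw [if_pos hb2]; linarith
      have e1 : (if la a < 485 / 1000 * L then f a else 0) = f a := if_pos haH
      rw [e1]
      linarith [mul_le_mul_of_nonneg_left hcov (hf a)]
    · rcases le_or_gt (la a) (525 / 1000 * L) with haM | haC
      · -- mid `a`: mid or dear partners
        have hbC : ¬ 525 / 1000 * L < lb b := fun h => by linarith
        have hcov : g b ≤ (if 485 / 1000 * L ≤ lb b ∧ lb b ≤ 525 / 1000 * L then g b else 0)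
            + (if lb b < 485 / 1000 * L then g b else 0) := by
          rcases lt_or_ge (lb b) (485 / 1000 * L) with hb | hb
          · rw [if_pos hb]; linarith
          · rw [if_pos (And.intro hb (not_lt.1 hbC))]; linarith
        have e2 : (if 485 / 1000 * L ≤ la a ∧ la a ≤ 525 / 1000 * L then f a else 0) = f a :=
          if_pos (And.intro haH haM)
        rw [e2]
        linarith [mul_le_mul_of_nonneg_left hcov (hf a)]
      · -- cheap `a`: dear partners only
        have hbH : lb b < 485 / 1000 * L := by linarith
        have e3 : (if 525 / 1000 * L < la a then f a else 0) = f a := if_pos haC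
        have e4 : f a * (if lb b < 485 / 1000 * L then g b else 0) = f a * g b := by
          rw [if_pos hbH]
        rw [e3]
        linarith
  calc ∑ a, ∑ b, (if Dep a b then f a * g b else 0)
      ≤ ∑ a, ∑ b, ((if la a < 485 / 1000 * L then f a else 0)
          * ((if 525 / 1000 * L < lb b then g b else 0)
            + (if 485 / 1000 * L ≤ lb b ∧ lb b ≤ 525 / 1000 * L then g b else 0)
            + (if lb b < 485 / 1000 * L then g b else 0))
        + (if 485 / 1000 * L ≤ la a ∧ la a ≤ 525 / 1000 * L then f a else 0)
          * ((if 485 / 1000 * L ≤ lb b ∧ lb b ≤ 525 / 1000 * L then g b else 0)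
            + (if lb b < 485 / 1000 * L then g b else 0))
        + (if 525 / 1000 * L < la a then f a else 0)
          * (if lb b < 485 / 1000 * L then g b else 0)) :=
        Finset.sum_le_sum fun a _ => Finset.sum_le_sum fun b _ => hpt a b
    _ = _ := by
        simp only [Finset.sum_add_distrib, ← Finset.mul_sum, ← Finset.sum_mul]

/-- Completing the square in the `T`-overlap `Hi` (STEP E'): if the penalty dominates
`(225/512)·M·Q` and `Hi² ≤ mm·Q` (Cauchy–Schwarz over the `mm = m²` pairs, `Q` the sum of squares),
then `(100/99)·Hi·W ≤ Pen + W²·mm/M` (the optimum of the quadratic is `(100/99)²(512/900) W² mm/M`).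
-/
theorem far_kept_tail_le {Hi W Pen Q M mm : ℝ} (hM0 : 0 < M) (hmm : 0 ≤ mm) (hHi : 0 ≤ Hi)
    (hQ : 0 ≤ Q) (hPen : 225 / 512 * M * Q ≤ Pen) (hCS : Hi ^ 2 ≤ mm * Q) :
    100 / 99 * Hi * W ≤ Pen + W ^ 2 * mm / M := by
  have hR : 0 ≤ W ^ 2 * mm / M := div_nonneg (mul_nonneg (sq_nonneg W) hmm) hM0.le
  rcases hHi.eq_or_lt with h0 | hpos
  · rw [← h0]; linarith [mul_nonneg hM0.le hQ]
  rcases hQ.eq_or_lt with hQ0 | hQpos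
  · rw [← hQ0, mul_zero] at hCS; nlinarith
  have key1 : 100 / 99 * Hi * W * M * Q ≤ (225 / 512 * M * Q * M + W ^ 2 * mm) * Q := by
    nlinarith [sq_nonneg (W * Hi - 50 / 99 * (M * Q)), mul_le_mul_of_nonneg_left hCS (sq_nonneg W),
      sq_nonneg (M * Q), mul_pos hM0 hQpos]
  have key2 : 100 / 99 * Hi * W * M ≤ 225 / 512 * M * Q * M + W ^ 2 * mm :=
    le_of_mul_le_mul_right key1 hQpos
  calc 100 / 99 * Hi * W = 100 / 99 * Hi * W * M / M := (eq_div_iff hM0.ne').2 rfl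
    _ ≤ (225 / 512 * M * Q * M + W ^ 2 * mm) / M := div_le_div_of_nonneg_right key2 hM0.le
    _ = 225 / 512 * M * Q + W ^ 2 * mm / M := by rw [add_div, mul_div_cancel_right₀ _ hM0.ne']
    _ ≤ Pen + W ^ 2 * mm / M := by linarith

/-- **The scalar endgame (STEP E')** of `position_kept_bound_far`: from the classification bound
`hA`, the charged and budgeted bound `hEK` on the productive mass (`position_ratio_far` after
STEP F'), the penalty bound `hPen` and Cauchy–Schwarz `hCS`, conclude `SC ≤ (5/8) cost + slop`,
the `(Hi + B)·W` correction being absorbed by the penalty (`far_kept_tail_le`) and the slop. -/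
theorem far_kept_real_core {SC E Pen SX SY W cost Hi Q B M mm ε₂ T₁ : ℝ}
    (hA : SC ≤ E - Pen + ε₂ * (SX * SY) + T₁)
    (hEK : 99 / 100 * E ≤ 99 / 100 * (5 / 8) * cost + (Hi + B) * W)
    (hPen : 225 / 512 * M * Q ≤ Pen) (hCS : Hi ^ 2 ≤ mm * Q) (hQ : 0 ≤ Q) (hHi : 0 ≤ Hi)
    (hW0 : 0 ≤ W) (hWS : W ≤ SX + SY) (hB : 0 ≤ B) (hM0 : 0 < M) (hmm : 0 ≤ mm) :
    SC ≤ 5 / 8 * cost + (ε₂ * (SX * SY) + T₁ + 2 * (SX + SY) * B + (SX + SY) ^ 2 * mm / M) := by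
  have h1 := far_kept_tail_le (W := W) hM0 hmm hHi hQ hPen hCS
  have h2 : W ^ 2 * mm / M ≤ (SX + SY) ^ 2 * mm / M :=
    div_le_div_of_nonneg_right (mul_le_mul_of_nonneg_right (pow_le_pow_left₀ hW0 hWS 2) hmm) hM0.le
  have h3 : B * W ≤ B * (SX + SY) := mul_le_mul_of_nonneg_left hWS hB
  have h4 : 0 ≤ B * W := mul_nonneg hB hW0
  linarith

end Summit.MatrixMultiplication.MatrixMultiplication.Theorems.PolynomialSlack
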